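import Mathlib
import Summits.Ventures.PercRepro2.Tail2DBlockCalc

/-!
# (SD) on `(e ∧ e) ∥ (e ∧ e)` — the first parallel composition without a single-edge factor, by block certificates
(seat mine-b, cell pub-perc-repro2; conjectures/MINE-B.md §42)

`Z22 = P2 ∥ P2` with `P2 = e ∧ e` is the smallest parallel composition in which neither factor is a single edge:
the one-edge step (`sdomZ_par_free`, `sdomZ_leafPar`) does not apply, and (SD) there was a census fact.  Here it is
a theorem at EVERY clipped position (`sdomZ_Z22`), through the block calculus of `Tail2DBlockCalc.lean`: the seven
non-trivial instances `E(2,0) ≼ E(1,1)`, `E(1,1) ≼ E(0,2)`, `E(1,0) ≼ E(0,1)`, `E(0,0) ≼ E(0,1)`, `E(0,1) ≼ E(0,2)`,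
`E(2,0) ≼ E(1,0)`, `E(1,0) ≼ E(0,0)` are CERTIFICATES (`blockDom_par_of_certificate`) — mixtures of product
couplings of six blocks of the path (its tails `{RR}`, `{BB}`, `all`, the mixed cell `{RB, BR}` moved by the identity
only, the row `{b = 0}` and the column `{r = 0}`) with the path's dominations `{RR} ≼ {BB}`, `{RR} ≼ all`,
`all ≼ {BB}`, `{b = 0} ≼ {BB}`, `{RR} ≼ {r = 0}`, the weights read off the exact block LP (work/code/blocklp.py);
the coverage identities are checked configuration by configuration (16 each).  The remaining positions have an
empty source or target tail (`tailCount_Z22_big`).  The same engine checks every certificate of the derived-table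
census (§42.3: all 809 SP terms ≤ 8 edges) once its blocks and weights are written down.
-/

namespace Summit.Ventures.PercRepro2.Tail2D

open V2Closure Finset

/-- the two-edge path -/
abbrev P2 : V2Closure.SP := V2Closure.SP.ser V2Closure.SP.free V2Closure.SP.free

/-- sums over the four configurations of the path -/
theorem sum_P2 (g : P2.Conf → ℕ) :
    ∑ x, g x = g ((false, false) : V2Closure.SP.free.Conf × V2Closure.SP.free.Conf) + g ((false, true) : V2Closure.SP.free.Conf × V2Closure.SP.free.Conf)
      + g ((true, false) : V2Closure.SP.free.Conf × V2Closure.SP.free.Conf) + g ((true, true) : V2Closure.SP.free.Conf × V2Closure.SP.free.Conf) := by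
  refine Eq.trans (Fintype.sum_prod_type (fun p : V2Closure.SP.free.Conf × V2Closure.SP.free.Conf => g p)) ?_
  have h0 : ∑ a : V2Closure.SP.free.Conf, ∑ b : V2Closure.SP.free.Conf, g (a, b)
      = (∑ b : V2Closure.SP.free.Conf, g (true, b)) + ∑ b : V2Closure.SP.free.Conf, g (false, b) :=
    Fintype.sum_bool _
  have h1 : ∑ b : V2Closure.SP.free.Conf, g (true, b) = g (true, true) + g (true, false) := Fintype.sum_bool _
  have h2 : ∑ b : V2Closure.SP.free.Conf, g (false, b) = g (false, true) + g (false, false) := Fintype.sum_bool _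
  rw [h0, h1, h2]
  ring
/-- the blocks of the path used by the certificates, as label filters -/
def pRR : Finset P2.Conf := tailSet P2 1 0
/-- the tail `{BB}` of the path (all blue) -/
def pBB : Finset P2.Conf := tailSet P2 0 1
/-- the tail `E(0,0)` of the path (everything) -/
def pALL : Finset P2.Conf := tailSet P2 0 0
/-- the mixed cell `{RB, BR}` of the path (label `(0,0)`) -/
def pMIX : Finset P2.Conf := Finset.univ.filter (fun x : P2.Conf => P2.rLab x = 0 ∧ P2.bLab x = 0)
/-- the row `{b = 0}` of the path -/
def pROW0 : Finset P2.Conf := Finset.univ.filter (fun x : P2.Conf => P2.bLab x = 0)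
/-- the column `{r = 0}` of the path -/
def pCOL0 : Finset P2.Conf := Finset.univ.filter (fun x : P2.Conf => P2.rLab x = 0)
/-- the labels of the four configurations -/
theorem lab_FF : P2.rLab ((false, false) : V2Closure.SP.free.Conf × V2Closure.SP.free.Conf) = 1 ∧ P2.bLab ((false, false) : V2Closure.SP.free.Conf × V2Closure.SP.free.Conf) = 0 := by
  simp [SP.rLab, SP.bLab, serR, serB]
/-- the labels of `RB` -/
theorem lab_FT : P2.rLab ((false, true) : V2Closure.SP.free.Conf × V2Closure.SP.free.Conf) = 0 ∧ P2.bLab ((false, true) : V2Closure.SP.free.Conf × V2Closure.SP.free.Conf) = 0 := by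
  simp [SP.rLab, SP.bLab, serR, serB]
/-- the labels of `BR` -/
theorem lab_TF : P2.rLab ((true, false) : V2Closure.SP.free.Conf × V2Closure.SP.free.Conf) = 0 ∧ P2.bLab ((true, false) : V2Closure.SP.free.Conf × V2Closure.SP.free.Conf) = 0 := by
  simp [SP.rLab, SP.bLab, serR, serB]
/-- the labels of `BB` -/
theorem lab_TT : P2.rLab ((true, true) : V2Closure.SP.free.Conf × V2Closure.SP.free.Conf) = 0 ∧ P2.bLab ((true, true) : V2Closure.SP.free.Conf × V2Closure.SP.free.Conf) = 1 := by
  simp [SP.rLab, SP.bLab, serR, serB]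
/-- block sums of the path's blocks, explicitly -/
theorem blockSum_pRR (f : P2.Conf → ℕ) : blockSum P2 pRR f = f ((false, false) : V2Closure.SP.free.Conf × V2Closure.SP.free.Conf) := by
  unfold blockSum pRR tailSet
  rw [Finset.sum_filter, sum_P2]
  simp [lab_FF, lab_FT, lab_TF, lab_TT]
/-- the block sum over `{BB}` -/
theorem blockSum_pBB (f : P2.Conf → ℕ) : blockSum P2 pBB f = f ((true, true) : V2Closure.SP.free.Conf × V2Closure.SP.free.Conf) := by
  unfold blockSum pBB tailSet
  rw [Finset.sum_filter, sum_P2]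
  simp [lab_FF, lab_FT, lab_TF, lab_TT]
/-- the block sum over all four configurations -/
theorem blockSum_pALL (f : P2.Conf → ℕ) : blockSum P2 pALL f = f ((false, false) : V2Closure.SP.free.Conf × V2Closure.SP.free.Conf)
    + f ((false, true) : V2Closure.SP.free.Conf × V2Closure.SP.free.Conf) + f ((true, false) : V2Closure.SP.free.Conf × V2Closure.SP.free.Conf) + f ((true, true) : V2Closure.SP.free.Conf × V2Closure.SP.free.Conf) := by
  unfold blockSum pALL tailSet
  rw [Finset.sum_filter, sum_P2]
  simp [lab_FF, lab_FT, lab_TF, lab_TT]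
/-- the block sum over the mixed cell -/
theorem blockSum_pMIX (f : P2.Conf → ℕ) : blockSum P2 pMIX f = f ((false, true) : V2Closure.SP.free.Conf × V2Closure.SP.free.Conf)
    + f ((true, false) : V2Closure.SP.free.Conf × V2Closure.SP.free.Conf) := by
  unfold blockSum pMIX
  rw [Finset.sum_filter, sum_P2]
  simp [lab_FF, lab_FT, lab_TF, lab_TT]
/-- the block sum over the row `{b = 0}` -/
theorem blockSum_pROW0 (f : P2.Conf → ℕ) : blockSum P2 pROW0 f = f ((false, false) : V2Closure.SP.free.Conf × V2Closure.SP.free.Conf)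
    + f ((false, true) : V2Closure.SP.free.Conf × V2Closure.SP.free.Conf) + f ((true, false) : V2Closure.SP.free.Conf × V2Closure.SP.free.Conf) := by
  unfold blockSum pROW0
  rw [Finset.sum_filter, sum_P2]
  simp [lab_FF, lab_FT, lab_TF, lab_TT]
/-- the block sum over the column `{r = 0}` -/
theorem blockSum_pCOL0 (f : P2.Conf → ℕ) : blockSum P2 pCOL0 f = f ((false, true) : V2Closure.SP.free.Conf × V2Closure.SP.free.Conf)
    + f ((true, false) : V2Closure.SP.free.Conf × V2Closure.SP.free.Conf) + f ((true, true) : V2Closure.SP.free.Conf × V2Closure.SP.free.Conf) := by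
  unfold blockSum pCOL0
  rw [Finset.sum_filter, sum_P2]
  simp [lab_FF, lab_FT, lab_TF, lab_TT]
/-- `#{RR} = 1` -/
theorem card_pRR : pRR.card = 1 := by
  have := blockSum_pRR (fun _ => 1); simpa [blockSum] using this
/-- `#{BB} = 1` -/
theorem card_pBB : pBB.card = 1 := by
  have := blockSum_pBB (fun _ => 1); simpa [blockSum] using this
/-- the path has four configurations -/
theorem card_pALL : pALL.card = 4 := by
  have := blockSum_pALL (fun _ => 1); simpa [blockSum] using this
/-- the mixed cell has two configurations -/
theorem card_pMIX : pMIX.card = 2 := by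
  have := blockSum_pMIX (fun _ => 1); simpa [blockSum] using this
/-- the row `{b = 0}` has three configurations -/
theorem card_pROW0 : pROW0.card = 3 := by
  have := blockSum_pROW0 (fun _ => 1); simpa [blockSum] using this
/-- the column `{r = 0}` has three configurations -/
theorem card_pCOL0 : pCOL0.card = 3 := by
  have := blockSum_pCOL0 (fun _ => 1); simpa [blockSum] using this
/-- the order facts -/
theorem le_FF_FT : ((false, false) : V2Closure.SP.free.Conf × V2Closure.SP.free.Conf) ≤ ((false, true) : V2Closure.SP.free.Conf × V2Closure.SP.free.Conf) := ⟨le_rfl, Bool.false_le _⟩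
/-- `RR ≤ BR` -/
theorem le_FF_TF : ((false, false) : V2Closure.SP.free.Conf × V2Closure.SP.free.Conf) ≤ ((true, false) : V2Closure.SP.free.Conf × V2Closure.SP.free.Conf) := ⟨Bool.false_le _, le_rfl⟩
/-- `RR ≤ BB` -/
theorem le_FF_TT : ((false, false) : V2Closure.SP.free.Conf × V2Closure.SP.free.Conf) ≤ ((true, true) : V2Closure.SP.free.Conf × V2Closure.SP.free.Conf) := ⟨Bool.false_le _, Bool.false_le _⟩
/-- `RB ≤ BB` -/
theorem le_FT_TT : ((false, true) : V2Closure.SP.free.Conf × V2Closure.SP.free.Conf) ≤ ((true, true) : V2Closure.SP.free.Conf × V2Closure.SP.free.Conf) := ⟨Bool.false_le _, le_rfl⟩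
/-- `BR ≤ BB` -/
theorem le_TF_TT : ((true, false) : V2Closure.SP.free.Conf × V2Closure.SP.free.Conf) ≤ ((true, true) : V2Closure.SP.free.Conf × V2Closure.SP.free.Conf) := ⟨le_rfl, Bool.false_le _⟩
/-- the dominations of the path used by the certificates -/
theorem dom_RR_BB : BlockDom P2 pRR pBB := by
  intro f hf
  rw [blockSum_pRR, blockSum_pBB, card_pRR, card_pBB]
  have := hf le_FF_TT; omega
/-- `{RR} ≼ all` (Harris on the path) -/
theorem dom_RR_ALL : BlockDom P2 pRR pALL := by
  intro f hf
  rw [blockSum_pRR, blockSum_pALL, card_pRR, card_pALL]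
  have := hf le_FF_FT; have := hf le_FF_TF; have := hf le_FF_TT; omega
/-- `all ≼ {BB}` (Harris on the path) -/
theorem dom_ALL_BB : BlockDom P2 pALL pBB := by
  intro f hf
  rw [blockSum_pBB, blockSum_pALL, card_pBB, card_pALL]
  have := hf le_FF_TT; have := hf le_FT_TT; have := hf le_TF_TT; omega
/-- the row `{b = 0}` is dominated by `{BB}` -/
theorem dom_ROW0_BB : BlockDom P2 pROW0 pBB := by
  intro f hf
  rw [blockSum_pBB, blockSum_pROW0, card_pBB, card_pROW0]
  have := hf le_FF_TT; have := hf le_FT_TT; have := hf le_TF_TT; omega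
/-- `{RR}` is dominated by the column `{r = 0}` -/
theorem dom_RR_COL0 : BlockDom P2 pRR pCOL0 := by
  intro f hf
  rw [blockSum_pRR, blockSum_pCOL0, card_pRR, card_pCOL0]
  have := hf le_FF_FT; have := hf le_FF_TF; have := hf le_FF_TT; omega

/-- the product network `(e ∧ e) ∥ (e ∧ e)` -/
abbrev Z22 : V2Closure.SP := V2Closure.SP.par P2 P2

/-- the uniform density of a product block on `Z22`, coordinatewise -/
theorem unifDens_prod (A B : Finset P2.Conf) (x y : P2.Conf) :
    unifDens Z22 (A ×ˢ B) ((x, y) : P2.Conf × P2.Conf)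
      = if x ∈ A ∧ y ∈ B then ((A.card * B.card : ℕ) : ℚ)⁻¹ else 0 := by
  unfold unifDens
  show (if ((x, y) : P2.Conf × P2.Conf) ∈ (A ×ˢ B : Finset (P2.Conf × P2.Conf))
      then (((A ×ˢ B : Finset (P2.Conf × P2.Conf)).card : ℚ))⁻¹ else 0) = _
  simp only [Finset.mem_product, Finset.card_product]

/-- the uniform density of a tail set of `Z22`, coordinatewise -/
theorem unifDens_tail (a c : ℕ) (x y : P2.Conf) :
    unifDens Z22 (tailSet Z22 a c) ((x, y) : P2.Conf × P2.Conf)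
      = if a ≤ P2.rLab x + P2.rLab y ∧ c ≤ P2.bLab x + P2.bLab y then ((tailCount Z22 a c : ℕ) : ℚ)⁻¹ else 0 := by
  unfold unifDens
  rw [tailCount_eq_card]
  show (if ((x, y) : P2.Conf × P2.Conf) ∈ (Finset.univ.filter (fun p : P2.Conf × P2.Conf =>
      a ≤ parR P2.rLab P2.rLab p ∧ c ≤ parB P2.bLab P2.bLab p) : Finset (P2.Conf × P2.Conf))
      then _ else 0) = _
  simp only [Finset.mem_filter, Finset.mem_univ, true_and, parR, parB]

/-- the tail counts of `Z22` -/
theorem tailCount_Z22 (a c : ℕ) : tailCount Z22 a c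
    = ∑ x : P2.Conf, ∑ y : P2.Conf, if a ≤ P2.rLab x + P2.rLab y ∧ c ≤ P2.bLab x + P2.bLab y then 1 else 0 := by
  unfold tailCount
  rw [Finset.card_filter]
  show (∑ p : P2.Conf × P2.Conf, if a ≤ parR P2.rLab P2.rLab p ∧ c ≤ parB P2.bLab P2.bLab p then 1 else 0) = _
  rw [Fintype.sum_prod_type]
  simp only [parR, parB]
  rfl
/-- `#E(2,0) = 1` on `Z22` -/
theorem tailCount_Z22_20 : tailCount Z22 2 0 = 1 := by
  rw [tailCount_Z22, sum_P2]; simp only [sum_P2]; simp [lab_FF, lab_FT, lab_TF, lab_TT]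
/-- `#E(1,1) = 2` -/
theorem tailCount_Z22_11 : tailCount Z22 1 1 = 2 := by
  rw [tailCount_Z22, sum_P2]; simp only [sum_P2]; simp [lab_FF, lab_FT, lab_TF, lab_TT]
/-- `#E(1,0) = 7` -/
theorem tailCount_Z22_10 : tailCount Z22 1 0 = 7 := by
  rw [tailCount_Z22, sum_P2]; simp only [sum_P2]; simp [lab_FF, lab_FT, lab_TF, lab_TT]
/-- `#E(0,1) = 7` -/
theorem tailCount_Z22_01 : tailCount Z22 0 1 = 7 := by
  rw [tailCount_Z22, sum_P2]; simp only [sum_P2]; simp [lab_FF, lab_FT, lab_TF, lab_TT]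
/-- `#E(0,0) = 16` -/
theorem tailCount_Z22_00 : tailCount Z22 0 0 = 16 := by
  rw [tailCount_Z22, sum_P2]; simp only [sum_P2]; simp [lab_FF, lab_FT, lab_TF, lab_TT]
/-- `#E(0,2) = 1` -/
theorem tailCount_Z22_02 : tailCount Z22 0 2 = 1 := by
  rw [tailCount_Z22, sum_P2]; simp only [sum_P2]; simp [lab_FF, lab_FT, lab_TF, lab_TT]


/-- **(SD) on `Z22` at `(2, 0)`** -/
theorem sdomZ_Z22_20 : BlockDom Z22 (tailSet Z22 2 0) (tailSet Z22 1 1) := by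
  refine blockDom_par_of_certificate P2 P2 ![pRR, pRR] ![pRR, pBB] ![pRR, pRR] ![pBB, pRR] ![1/2, 1/2] ?_ ?_ ?_ ?_ _ _ ?_ ?_
  · intro k; fin_cases k <;> norm_num
  · intro k; fin_cases k <;> simp [blockDom_refl, dom_RR_BB]
  · intro k; fin_cases k <;> simp [blockDom_refl, dom_RR_BB]
  · intro k _ _; fin_cases k <;> simp [← Finset.card_pos, card_pBB, card_pRR]
  · rintro ⟨x, y⟩
    simp only [Fin.sum_univ_succ, Fin.sum_univ_zero, Matrix.cons_val_zero, Matrix.cons_val_succ,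
      unifDens_prod, unifDens_tail, card_pRR, tailCount_Z22_20]
    rcases x with ⟨a, b⟩; rcases y with ⟨c, d⟩
    cases a <;> cases b <;> cases c <;> cases d <;> first | (simp +decide []; done) | (simp +decide []; norm_num)
  · rintro ⟨x, y⟩
    simp only [Fin.sum_univ_succ, Fin.sum_univ_zero, Matrix.cons_val_zero, Matrix.cons_val_succ,
      unifDens_prod, unifDens_tail, card_pBB, card_pRR, tailCount_Z22_11]
    rcases x with ⟨a, b⟩; rcases y with ⟨c, d⟩
    cases a <;> cases b <;> cases c <;> cases d <;> simp +decide []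

/-- **(SD) on `Z22` at `(1, 1)`** -/
theorem sdomZ_Z22_11 : BlockDom Z22 (tailSet Z22 1 1) (tailSet Z22 0 2) := by
  refine blockDom_par_of_certificate P2 P2 ![pRR, pBB] ![pBB, pBB] ![pBB, pRR] ![pBB, pBB] ![1/2, 1/2] ?_ ?_ ?_ ?_ _ _ ?_ ?_
  · intro k; fin_cases k <;> norm_num
  · intro k; fin_cases k <;> simp [blockDom_refl, dom_RR_BB]
  · intro k; fin_cases k <;> simp [blockDom_refl, dom_RR_BB]
  · intro k _ _; fin_cases k <;> simp [← Finset.card_pos, card_pBB]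
  · rintro ⟨x, y⟩
    simp only [Fin.sum_univ_succ, Fin.sum_univ_zero, Matrix.cons_val_zero, Matrix.cons_val_succ,
      unifDens_prod, unifDens_tail, card_pBB, card_pRR, tailCount_Z22_11]
    rcases x with ⟨a, b⟩; rcases y with ⟨c, d⟩
    cases a <;> cases b <;> cases c <;> cases d <;> simp +decide []
  · rintro ⟨x, y⟩
    simp only [Fin.sum_univ_succ, Fin.sum_univ_zero, Matrix.cons_val_zero, Matrix.cons_val_succ,
      unifDens_prod, unifDens_tail, card_pBB, tailCount_Z22_02]
    rcases x with ⟨a, b⟩; rcases y with ⟨c, d⟩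
    cases a <;> cases b <;> cases c <;> cases d <;> first | (simp +decide []; done) | (simp +decide []; norm_num)

/-- **(SD) on `Z22` at `(1, 0)`** -/
theorem sdomZ_Z22_10 : BlockDom Z22 (tailSet Z22 1 0) (tailSet Z22 0 1) := by
  refine blockDom_par_of_certificate P2 P2 ![pRR, pRR, pRR, pRR, pMIX, pBB] ![pBB, pBB, pBB, pRR, pMIX, pBB] ![pRR, pMIX, pBB, pALL, pRR, pRR] ![pRR, pMIX, pBB, pBB, pBB, pALL] ![3/28, 3/14, 3/28, 1/7, 2/7, 1/7] ?_ ?_ ?_ ?_ _ _ ?_ ?_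
  · intro k; fin_cases k <;> norm_num
  · intro k; fin_cases k <;> simp [blockDom_refl, dom_RR_BB]
  · intro k; fin_cases k <;> simp [blockDom_refl, dom_ALL_BB, dom_RR_ALL, dom_RR_BB]
  · intro k _ _; fin_cases k <;> simp [← Finset.card_pos, card_pALL, card_pBB, card_pMIX, card_pRR]
  · rintro ⟨x, y⟩
    simp only [Fin.sum_univ_succ, Fin.sum_univ_zero, Matrix.cons_val_zero, Matrix.cons_val_succ,
      unifDens_prod, unifDens_tail, card_pALL, card_pBB, card_pMIX, card_pRR, tailCount_Z22_10]
    rcases x with ⟨a, b⟩; rcases y with ⟨c, d⟩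
    cases a <;> cases b <;> cases c <;> cases d <;> first | (simp +decide []; done) | (simp +decide []; norm_num)
  · rintro ⟨x, y⟩
    simp only [Fin.sum_univ_succ, Fin.sum_univ_zero, Matrix.cons_val_zero, Matrix.cons_val_succ,
      unifDens_prod, unifDens_tail, card_pALL, card_pBB, card_pMIX, card_pRR, tailCount_Z22_01]
    rcases x with ⟨a, b⟩; rcases y with ⟨c, d⟩
    cases a <;> cases b <;> cases c <;> cases d <;> first | (simp +decide []; done) | (simp +decide []; norm_num)

/-- **(SD) on `Z22` at `(0, 0)`** -/
theorem sdomZ_Z22_00 : BlockDom Z22 (tailSet Z22 0 0) (tailSet Z22 0 1) := by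
  refine blockDom_par_of_certificate P2 P2 ![pRR, pRR, pMIX, pMIX, pBB, pBB, pALL, pALL] ![pRR, pRR, pMIX, pMIX, pBB, pBB, pBB, pBB] ![pBB, pALL, pBB, pALL, pBB, pALL, pRR, pMIX] ![pBB, pBB, pBB, pBB, pBB, pBB, pRR, pMIX] ![1/28, 3/28, 1/14, 3/14, 1/28, 3/28, 1/7, 2/7] ?_ ?_ ?_ ?_ _ _ ?_ ?_
  · intro k; fin_cases k <;> norm_num
  · intro k; fin_cases k <;> simp [blockDom_refl, dom_ALL_BB]
  · intro k; fin_cases k <;> simp [blockDom_refl, dom_ALL_BB]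
  · intro k _ _; fin_cases k <;> simp [← Finset.card_pos, card_pBB, card_pMIX, card_pRR]
  · rintro ⟨x, y⟩
    simp only [Fin.sum_univ_succ, Fin.sum_univ_zero, Matrix.cons_val_zero, Matrix.cons_val_succ,
      unifDens_prod, unifDens_tail, card_pALL, card_pBB, card_pMIX, card_pRR, tailCount_Z22_00]
    rcases x with ⟨a, b⟩; rcases y with ⟨c, d⟩
    cases a <;> cases b <;> cases c <;> cases d <;> first | (simp +decide []; done) | (simp +decide []; norm_num)
  · rintro ⟨x, y⟩
    simp only [Fin.sum_univ_succ, Fin.sum_univ_zero, Matrix.cons_val_zero, Matrix.cons_val_succ,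
      unifDens_prod, unifDens_tail, card_pBB, card_pMIX, card_pRR, tailCount_Z22_01]
    rcases x with ⟨a, b⟩; rcases y with ⟨c, d⟩
    cases a <;> cases b <;> cases c <;> cases d <;> first | (simp +decide []; done) | (simp +decide []; norm_num)

/-- **(SD) on `Z22` at `(0, 1)`** -/
theorem sdomZ_Z22_01 : BlockDom Z22 (tailSet Z22 0 1) (tailSet Z22 0 2) := by
  refine blockDom_par_of_certificate P2 P2 ![pBB, pALL] ![pBB, pBB] ![pROW0, pBB] ![pBB, pBB] ![3/7, 4/7] ?_ ?_ ?_ ?_ _ _ ?_ ?_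
  · intro k; fin_cases k <;> norm_num
  · intro k; fin_cases k <;> simp [blockDom_refl, dom_ALL_BB]
  · intro k; fin_cases k <;> simp [blockDom_refl, dom_ROW0_BB]
  · intro k _ _; fin_cases k <;> simp [← Finset.card_pos, card_pBB]
  · rintro ⟨x, y⟩
    simp only [Fin.sum_univ_succ, Fin.sum_univ_zero, Matrix.cons_val_zero, Matrix.cons_val_succ,
      unifDens_prod, unifDens_tail, card_pALL, card_pBB, card_pROW0, tailCount_Z22_01]
    rcases x with ⟨a, b⟩; rcases y with ⟨c, d⟩
    cases a <;> cases b <;> cases c <;> cases d <;> first | (simp +decide []; done) | (simp +decide []; norm_num)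
  · rintro ⟨x, y⟩
    simp only [Fin.sum_univ_succ, Fin.sum_univ_zero, Matrix.cons_val_zero, Matrix.cons_val_succ,
      unifDens_prod, unifDens_tail, card_pBB, tailCount_Z22_02]
    rcases x with ⟨a, b⟩; rcases y with ⟨c, d⟩
    cases a <;> cases b <;> cases c <;> cases d <;> first | (simp +decide []; done) | (simp +decide []; norm_num)

/-- **(SD) on `Z22` at `(2, −1) (clipped: E(2,0) → E(1,0))`** -/
theorem sdomZ_Z22_2m : BlockDom Z22 (tailSet Z22 2 0) (tailSet Z22 1 0) := by
  refine blockDom_par_of_certificate P2 P2 ![pRR, pRR] ![pALL, pRR] ![pRR, pRR] ![pRR, pCOL0] ![4/7, 3/7] ?_ ?_ ?_ ?_ _ _ ?_ ?_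
  · intro k; fin_cases k <;> norm_num
  · intro k; fin_cases k <;> simp [blockDom_refl, dom_RR_ALL]
  · intro k; fin_cases k <;> simp [blockDom_refl, dom_RR_COL0]
  · intro k _ _; fin_cases k <;> simp [← Finset.card_pos, card_pALL, card_pCOL0, card_pRR]
  · rintro ⟨x, y⟩
    simp only [Fin.sum_univ_succ, Fin.sum_univ_zero, Matrix.cons_val_zero, Matrix.cons_val_succ,
      unifDens_prod, unifDens_tail, card_pRR, tailCount_Z22_20]
    rcases x with ⟨a, b⟩; rcases y with ⟨c, d⟩
    cases a <;> cases b <;> cases c <;> cases d <;> first | (simp +decide []; done) | (simp +decide []; norm_num)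
  · rintro ⟨x, y⟩
    simp only [Fin.sum_univ_succ, Fin.sum_univ_zero, Matrix.cons_val_zero, Matrix.cons_val_succ,
      unifDens_prod, unifDens_tail, card_pALL, card_pCOL0, card_pRR, tailCount_Z22_10]
    rcases x with ⟨a, b⟩; rcases y with ⟨c, d⟩
    cases a <;> cases b <;> cases c <;> cases d <;> first | (simp +decide []; done) | (simp +decide []; norm_num)

/-- **(SD) on `Z22` at `(1, −1) (clipped: E(1,0) → E(0,0))`** -/
theorem sdomZ_Z22_1m : BlockDom Z22 (tailSet Z22 1 0) (tailSet Z22 0 0) := by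
  refine blockDom_par_of_certificate P2 P2 ![pRR, pRR, pRR, pRR, pRR, pRR, pMIX, pBB] ![pALL, pRR, pALL, pRR, pALL, pRR, pMIX, pBB] ![pRR, pRR, pMIX, pMIX, pBB, pBB, pRR, pRR] ![pRR, pRR, pMIX, pMIX, pBB, pBB, pALL, pALL] ![3/28, 1/28, 3/14, 1/14, 3/28, 1/28, 2/7, 1/7] ?_ ?_ ?_ ?_ _ _ ?_ ?_
  · intro k; fin_cases k <;> norm_num
  · intro k; fin_cases k <;> simp [blockDom_refl, dom_RR_ALL]
  · intro k; fin_cases k <;> simp [blockDom_refl, dom_RR_ALL]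
  · intro k _ _; fin_cases k <;> simp [← Finset.card_pos, card_pALL, card_pBB, card_pMIX, card_pRR]
  · rintro ⟨x, y⟩
    simp only [Fin.sum_univ_succ, Fin.sum_univ_zero, Matrix.cons_val_zero, Matrix.cons_val_succ,
      unifDens_prod, unifDens_tail, card_pBB, card_pMIX, card_pRR, tailCount_Z22_10]
    rcases x with ⟨a, b⟩; rcases y with ⟨c, d⟩
    cases a <;> cases b <;> cases c <;> cases d <;> first | (simp +decide []; done) | (simp +decide []; norm_num)
  · rintro ⟨x, y⟩
    simp only [Fin.sum_univ_succ, Fin.sum_univ_zero, Matrix.cons_val_zero, Matrix.cons_val_succ,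
      unifDens_prod, unifDens_tail, card_pALL, card_pBB, card_pMIX, card_pRR, tailCount_Z22_00]
    rcases x with ⟨a, b⟩; rcases y with ⟨c, d⟩
    cases a <;> cases b <;> cases c <;> cases d <;> first | (simp +decide []; done) | (simp +decide []; norm_num)

/-- (SD) at a clipped position is trivial when the source or the target tail is empty -/
theorem sdomZ_of_tailCount_zero (s : V2Closure.SP) (u v : ℤ)
    (h : tailCount s u.toNat v.toNat = 0 ∨ tailCount s (u - 1).toNat (v + 1).toNat = 0) : SDomZ s u v := by
  intro f hf
  rcases h with h | h
  · have e : tailSet s u.toNat v.toNat = ∅ := Finset.card_eq_zero.1 h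
    simp [tailSum, e]
  · rw [h]; simp

/-- (SD) depends only on the clipped positions -/
theorem sdomZ_congr (s : V2Closure.SP) {u v u' v' : ℤ} (h1 : u.toNat = u'.toNat) (h2 : (u - 1).toNat = (u' - 1).toNat)
    (h3 : v.toNat = v'.toNat) (h4 : (v + 1).toNat = (v' + 1).toNat) (h : SDomZ s u' v') : SDomZ s u v := by
  unfold SDomZ at h ⊢
  rw [h1, h2, h3, h4]
  exact h
/-- the tails of `Z22` beyond the total flow `2` are empty -/
theorem tailCount_Z22_big (a c : ℕ) (h : 3 ≤ a + c) : tailCount Z22 a c = 0 := by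
  rw [tailCount_Z22, sum_P2]; simp only [sum_P2]
  simp only [lab_FF, lab_FT, lab_TF, lab_TT]
  split_ifs <;> omega

/-- the seven clipped instances, in the lane's `SDomZ` form -/
theorem sdomZ_Z22_i20 : SDomZ Z22 2 0 := by rw [sdomZ_iff_blockDom]; exact sdomZ_Z22_20
/-- the clipped instance `(1,1)` -/
theorem sdomZ_Z22_i11 : SDomZ Z22 1 1 := by rw [sdomZ_iff_blockDom]; exact sdomZ_Z22_11
/-- the clipped instance `(1,0)` -/
theorem sdomZ_Z22_i10 : SDomZ Z22 1 0 := by rw [sdomZ_iff_blockDom]; exact sdomZ_Z22_10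
/-- the clipped instance `(0,0)` -/
theorem sdomZ_Z22_i00 : SDomZ Z22 0 0 := by rw [sdomZ_iff_blockDom]; exact sdomZ_Z22_00
/-- the clipped instance `(0,1)` -/
theorem sdomZ_Z22_i01 : SDomZ Z22 0 1 := by rw [sdomZ_iff_blockDom]; exact sdomZ_Z22_01
/-- the clipped instance `(2,−1)`: `E(2,0) ≼ E(1,0)` -/
theorem sdomZ_Z22_i2m : SDomZ Z22 2 (-1) := by rw [sdomZ_iff_blockDom]; exact sdomZ_Z22_2m
/-- the clipped instance `(1,−1)`: `E(1,0) ≼ E(0,0)` -/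
theorem sdomZ_Z22_i1m : SDomZ Z22 1 (-1) := by rw [sdomZ_iff_blockDom]; exact sdomZ_Z22_1m
/-- the clipped instance `(0,−1)`: the identity on `E(0,0)` -/
theorem sdomZ_Z22_i0m : SDomZ Z22 0 (-1) := by rw [sdomZ_iff_blockDom]; exact blockDom_refl _ _

/-- **(SD) at every clipped position on `(e ∧ e) ∥ (e ∧ e)`** — the first parallel composition with no
single-edge factor, by the seven block certificates -/
theorem sdomZ_Z22 (u v : ℤ) : SDomZ Z22 u v := by
  rcases (show u ≤ 0 ∨ 0 < u by omega) with hu0 | hu0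
  · rcases (show v ≤ -1 ∨ -1 < v by omega) with hv | hv
    · exact sdomZ_congr Z22 (u' := 0) (v' := -1) (by omega) (by omega) (by omega) (by omega) sdomZ_Z22_i0m
    · rcases (show v = 0 ∨ v = 1 ∨ 2 ≤ v by omega) with hv | hv | hv
      · exact sdomZ_congr Z22 (u' := 0) (v' := 0) (by omega) (by omega) (by omega) (by omega) sdomZ_Z22_i00
      · exact sdomZ_congr Z22 (u' := 0) (v' := 1) (by omega) (by omega) (by omega) (by omega) sdomZ_Z22_i01
      · exact sdomZ_of_tailCount_zero Z22 u v (Or.inr (tailCount_Z22_big _ _ (by omega)))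
  · rcases (show u = 1 ∨ u = 2 ∨ 3 ≤ u by omega) with hu | hu | hu
    · rcases (show v ≤ -1 ∨ -1 < v by omega) with hv | hv
      · exact sdomZ_congr Z22 (u' := 1) (v' := -1) (by omega) (by omega) (by omega) (by omega) sdomZ_Z22_i1m
      · rcases (show v = 0 ∨ v = 1 ∨ 2 ≤ v by omega) with hv | hv | hv
        · exact sdomZ_congr Z22 (u' := 1) (v' := 0) (by omega) (by omega) (by omega) (by omega) sdomZ_Z22_i10
        · exact sdomZ_congr Z22 (u' := 1) (v' := 1) (by omega) (by omega) (by omega) (by omega) sdomZ_Z22_i11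
        · exact sdomZ_of_tailCount_zero Z22 u v (Or.inr (tailCount_Z22_big _ _ (by omega)))
    · rcases (show v ≤ -1 ∨ -1 < v by omega) with hv | hv
      · exact sdomZ_congr Z22 (u' := 2) (v' := -1) (by omega) (by omega) (by omega) (by omega) sdomZ_Z22_i2m
      · rcases (show v = 0 ∨ 1 ≤ v by omega) with hv | hv
        · exact sdomZ_congr Z22 (u' := 2) (v' := 0) (by omega) (by omega) (by omega) (by omega) sdomZ_Z22_i20
        · exact sdomZ_of_tailCount_zero Z22 u v (Or.inl (tailCount_Z22_big _ _ (by omega)))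
    · exact sdomZ_of_tailCount_zero Z22 u v (Or.inl (tailCount_Z22_big _ _ (by omega)))

end Summit.Ventures.PercRepro2.Tail2D
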